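import Summits.CriticalPhenomena.PercolationContinuityZ3.Theorems.PercNearOneGluingNoHeavyLowerTailAntitheticSealing
import HarnessLib

/-!
# `NoHeavyLowerTail` (stmt-CriticalPhenomena-4575) — antithetic cluster pairs: LOBES of the disjoint slice `W ∩ W' = {s}`
# (prim-hp-2 gen 31/36; THEOREM-D-disjoint-slice.md Lemmas 1–2, MEMO-gen36 §3)

Support file (`--supports stmt-CriticalPhenomena-4575`, hull-port prover `prim-hp-2`, gen 36).  No named facts, no sorries; standard
axioms.  The `def`s (`Antithetic.Slice.*`) are the proof-internal bookkeeping of THEOREM D (the disjoint slice of the antithetic sum is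
nonnegative on every finite graph), proved in the companion file `…AntitheticSlice`: for a colouring `T` (red edges) of an edge set `E`
with source `s`,
* `Slice.uni E s T` — `U = W ∪ W'`, the vertices joined to `s` in red or in blue;
* `Slice.inner E s T` — the edges of `E` with both endpoints in `U ∖ s`;
* `Slice.lobe E s T x` — the LOBE of `x`, its component in `G[U ∖ s]`; `Slice.lblock` — the lobe block `S(K) = {e ∈ E : e meets K}`;
* `Slice.lalg` — the Boolean algebra of edge sets splitting no lobe block; `Slice.ltop` — the top colouring (every lobe red-attached,
  red elsewhere); `Slice.lpart` — the part `{ltop ∆ A : A ∈ lalg}` of `T`; `Slice.sealedSet B` — the lobes inside `B` together with `V ∖ U`.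

Lemmas (slice `W ∩ W' = {s}`): lobes lie in `U ∖ s` and are monochromatic (`red_iff_of_mem_lobe`); an edge into a lobe from the rest of
`U` comes from `s` and carries the lobe's colour (`eq_apex_of_boundary`, `spoke_iff`); an edge leaving `U` carries the colour in which
its `U`-endpoint is not reached (`outer_edge`, Lemma 1 of the theorem file); overlapping blocks have the same colour
(`red_iff_of_mem_lblock`), so the top colouring is well defined blockwise (`mem_ltop_iff`, `ltop_agree`), `T` lies in its part
(`mem_lpart_self`), and the sealed set of `B ∈ lalg` admits no red edge of `ltop ∆ B` from outside (`sealed`).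
[cite: VandenbergHaggstromKahn2005, §1 p. 3 (open cluster `C_s`)]
-/

noncomputable section

namespace Summit.CriticalPhenomena.PercolationContinuityZ3.Theorems

open Literature.Probability.Percolation
open scoped Classical symmDiff

namespace Antithetic

namespace Slice

variable {V : Type*}

/-- `U = W ∪ W'`: the vertices joined to `s` in red or in blue. [this work] -/
def uni (E : Set (Sym2 V)) (s : V) (T : Set (Sym2 V)) : Set V :=
  {v | (openGraph (T ∩ E)).Reachable s v ∨ (openGraph (Tᶜ ∩ E)).Reachable s v}

/-- The edges of `E` with both endpoints in `U ∖ {s}` (colour-blind). [this work] -/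
def inner (E : Set (Sym2 V)) (s : V) (T : Set (Sym2 V)) : Set (Sym2 V) :=
  {e | e ∈ E ∧ ∀ v ∈ e, v ∈ uni E s T ∧ v ≠ s}

/-- The LOBE of `x`: its component in `G[U ∖ s]` (THEOREM-D-disjoint-slice.md, Lemma 2). [this work] -/
def lobe (E : Set (Sym2 V)) (s : V) (T : Set (Sym2 V)) (x : V) : Set V := openCluster (inner E s T) x

/-- The lobe BLOCK `S(K_x) = {e ∈ E : e meets K_x}`. [this work] -/
def lblock (E : Set (Sym2 V)) (s : V) (T : Set (Sym2 V)) (x : V) : Set (Sym2 V) :=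
  {e | e ∈ E ∧ ∃ y ∈ lobe E s T x, y ∈ e}

/-- The block ALGEBRA: edge sets splitting no lobe block. [this work] -/
def lalg (E : Set (Sym2 V)) (s : V) (T : Set (Sym2 V)) : Set (Set (Sym2 V)) :=
  {A | ∀ x ∈ uni E s T \ {s}, lblock E s T x ⊆ A ∨ Disjoint (lblock E s T x) A}

/-- The TOP colouring: every lobe block recoloured so that the lobe is red-attached; red elsewhere. [this work] -/
def ltop (E : Set (Sym2 V)) (s : V) (T : Set (Sym2 V)) : Set (Sym2 V) :=
  {e | ∀ x ∈ uni E s T \ {s}, e ∈ lblock E s T x → (e ∈ T ↔ (openGraph (T ∩ E)).Reachable s x)}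

/-- The PART of `T`: `{ltop ∆ A : A ∈ lalg}`. [this work] -/
def lpart [Fintype V] (E : Set (Sym2 V)) (s : V) (T : Set (Sym2 V)) : Finset (Set (Sym2 V)) :=
  (Finset.univ.filter fun A => A ∈ lalg E s T).image fun A => ltop E s T ∆ A

/-- The SEALED SET of `B ∈ lalg`: the lobes whose blocks lie inside `B`, together with `V ∖ U`. [this work] -/
def sealedSet (E : Set (Sym2 V)) (s : V) (T : Set (Sym2 V)) (B : Set (Sym2 V)) : Set V :=
  {v | ∃ x ∈ uni E s T \ {s}, lblock E s T x ⊆ B ∧ v ∈ lobe E s T x} ∪ (uni E s T)ᶜ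

section Basic

variable {E : Set (Sym2 V)} {s : V} {T : Set (Sym2 V)}

/-- `s ∈ U`. [this work] -/
theorem apex_mem_uni : s ∈ uni E s T := Or.inl (SimpleGraph.Reachable.refl s)

/-- `x` lies in its own lobe. [this work] -/
theorem mem_lobe_self (x : V) : x ∈ lobe E s T x := mem_openCluster_self _ x

/-- No inner edge contains `s`. [this work] -/
theorem not_mem_inner_of_mem {e : Sym2 V} (he : s ∈ e) : e ∉ inner E s T := fun h => (h.2 s he).2 rfl

/-- `s` lies in no lobe of a vertex `x ≠ s`. [this work] -/
theorem apex_not_mem_lobe {x : V} (hxs : x ≠ s) : s ∉ lobe E s T x := fun h =>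
  (reachable_of_sealed (inner E s T) (inner E s T) x {s} hxs (fun _ _ _ _ => Iff.rfl)
    (fun a b _ (hb : b ∈ ({s} : Set V)) => by
      rw [Set.mem_singleton_iff] at hb
      rw [hb]
      exact not_mem_inner_of_mem (Sym2.mem_mk_right a s)) h).2 rfl

/-- A lobe of a vertex of `U ∖ s` lies inside `U ∖ s`. [this work] -/
theorem mem_uni_of_mem_lobe {x : V} (hx : x ∈ uni E s T ∧ x ≠ s) {y : V} (hy : y ∈ lobe E s T x) : y ∈ uni E s T ∧ y ≠ s := by
  obtain ⟨p⟩ := (show (openGraph (inner E s T)).Reachable x y from hy)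
  suffices h : ∀ {a b : V} (_ : (openGraph (inner E s T)).Walk a b), (a ∈ uni E s T ∧ a ≠ s) → (b ∈ uni E s T ∧ b ≠ s) from h p hx
  intro a b q
  induction q with
  | nil => exact id
  | @cons a c b hac _ ih =>
    intro _
    rw [openGraph_adj] at hac
    exact ih (hac.1.2 c (Sym2.mem_mk_right a c))

/-- **Lobes are monochromatic** (THEOREM-D-disjoint-slice.md, proof of Thm D): in the slice `W ∩ W' = {s}`, two vertices of `U ∖ s` joined
by an inner edge are both red-reached or both not. [this work] -/
theorem red_iff_of_inner_adj (hI : ∀ v, v ≠ s → ¬ ((openGraph (T ∩ E)).Reachable s v ∧ (openGraph (Tᶜ ∩ E)).Reachable s v))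
    {a b : V} (hab : s(a, b) ∈ inner E s T) (hne : a ≠ b) :
    ((openGraph (T ∩ E)).Reachable s a ↔ (openGraph (T ∩ E)).Reachable s b) := by
  -- one direction, for any ordered pair
  have key : ∀ a b : V, s(a, b) ∈ inner E s T → a ≠ b → (openGraph (T ∩ E)).Reachable s a →
      (openGraph (T ∩ E)).Reachable s b := by
    intro a b hab hne ha
    by_contra hb
    have hbU : b ∈ uni E s T := (hab.2 b (Sym2.mem_mk_right a b)).1
    have hbblue : (openGraph (Tᶜ ∩ E)).Reachable s b := hbU.resolve_left hb
    by_cases hT : s(a, b) ∈ T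
    · exact hb (ha.trans ((openGraph_adj (T ∩ E) a b).2 ⟨⟨hT, hab.1⟩, hne⟩).reachable)
    · have hba : (openGraph (Tᶜ ∩ E)).Adj b a := by
        rw [openGraph_adj, Sym2.eq_swap]
        exact ⟨⟨hT, hab.1⟩, hne.symm⟩
      exact hI a (hab.2 a (Sym2.mem_mk_left a b)).2 ⟨ha, hbblue.trans hba.reachable⟩
  refine ⟨key a b hab hne, key b a ?_ hne.symm⟩
  rw [Sym2.eq_swap]; exact hab

/-- Vertices of one lobe are all red-reached or all not. [this work] -/
theorem red_iff_of_mem_lobe (hI : ∀ v, v ≠ s → ¬ ((openGraph (T ∩ E)).Reachable s v ∧ (openGraph (Tᶜ ∩ E)).Reachable s v))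
    {x y : V} (hy : y ∈ lobe E s T x) :
    ((openGraph (T ∩ E)).Reachable s x ↔ (openGraph (T ∩ E)).Reachable s y) := by
  obtain ⟨p⟩ := (show (openGraph (inner E s T)).Reachable x y from hy)
  clear hy
  induction p with
  | nil => exact Iff.rfl
  | @cons a c b hac _ ih =>
    rw [openGraph_adj] at hac
    exact (red_iff_of_inner_adj hI hac.1 hac.2).trans ih

/-- An inner edge at a lobe vertex stays in the lobe. [this work] -/
theorem mem_lobe_of_adj {x a b : V} (ha : a ∈ lobe E s T x) (hab : s(a, b) ∈ inner E s T) (hne : a ≠ b) : b ∈ lobe E s T x :=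
  (show (openGraph (inner E s T)).Reachable x a from ha).trans ((openGraph_adj _ a b).2 ⟨hab, hne⟩).reachable

/-- **Boundary of a lobe inside `U`**: an edge from a vertex of `U` outside the lobe of `z` into it can only come from `s`. [this work] -/
theorem eq_apex_of_boundary {z x y : V} (hz : z ∈ uni E s T ∧ z ≠ s) (hxU : x ∈ uni E s T) (hx : x ∉ lobe E s T z)
    (hy : y ∈ lobe E s T z) (hxy : s(x, y) ∈ E) : x = s := by
  by_contra hxs
  have hyU := mem_uni_of_mem_lobe hz hy
  have hin : s(x, y) ∈ inner E s T := by
    refine ⟨hxy, fun v hv => ?_⟩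
    rcases Sym2.mem_iff.1 hv with rfl | rfl
    · exact ⟨hxU, hxs⟩
    · exact hyU
  have hne : y ≠ x := fun h => hx (h ▸ hy)
  exact hx (mem_lobe_of_adj hy (by rw [Sym2.eq_swap]; exact hin) hne)

/-- **Edges at `s` carry the lobe's colour**: for `y` in the lobe of `z ∈ U ∖ s`, an edge `sy` is red iff `z` is red-reached. [this work] -/
theorem spoke_iff (hI : ∀ v, v ≠ s → ¬ ((openGraph (T ∩ E)).Reachable s v ∧ (openGraph (Tᶜ ∩ E)).Reachable s v))
    {z y : V} (hz : z ∈ uni E s T ∧ z ≠ s) (hy : y ∈ lobe E s T z) (hsy : s(s, y) ∈ E) :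
    (s(s, y) ∈ T ↔ (openGraph (T ∩ E)).Reachable s z) := by
  have hyU := mem_uni_of_mem_lobe hz hy
  rw [red_iff_of_mem_lobe hI hy]
  constructor
  · intro h
    exact ((openGraph_adj (T ∩ E) s y).2 ⟨⟨h, hsy⟩, hyU.2.symm⟩).reachable
  · intro h
    by_contra hT
    exact hI y hyU.2 ⟨h, ((openGraph_adj (Tᶜ ∩ E) s y).2 ⟨⟨hT, hsy⟩, hyU.2.symm⟩).reachable⟩

/-- **Edges leaving `U`**: an edge from `x ∈ U` to `y ∉ U` has `x ≠ s` and the colour in which `x` is NOT reached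
(THEOREM-D-disjoint-slice.md, Lemma 1). [this work] -/
theorem outer_edge {x y : V} (hxU : x ∈ uni E s T) (hyU : y ∉ uni E s T) (hxy : s(x, y) ∈ E) :
    x ≠ s ∧ (s(x, y) ∈ T ↔ ¬ (openGraph (T ∩ E)).Reachable s x) := by
  have hne : x ≠ y := fun h => hyU (h ▸ hxU)
  have hred : (openGraph (T ∩ E)).Reachable s x → s(x, y) ∉ T := fun hx hT =>
    hyU (Or.inl (hx.trans ((openGraph_adj (T ∩ E) x y).2 ⟨⟨hT, hxy⟩, hne⟩).reachable))
  have hblue : (openGraph (Tᶜ ∩ E)).Reachable s x → s(x, y) ∈ T := fun hx => by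
    by_contra hT
    exact hyU (Or.inr (hx.trans ((openGraph_adj (Tᶜ ∩ E) x y).2 ⟨⟨hT, hxy⟩, hne⟩).reachable))
  refine ⟨fun hxs => ?_, ⟨fun hT hx => hred hx hT, fun hx => hblue (hxU.resolve_left hx)⟩⟩
  subst hxs
  rcases hxU with h | h
  · by_cases hT : s(x, y) ∈ T
    · exact hred (SimpleGraph.Reachable.refl x) hT
    · exact hT (hblue (SimpleGraph.Reachable.refl x))
  · by_cases hT : s(x, y) ∈ T
    · exact hred (SimpleGraph.Reachable.refl x) hT
    · exact hT (hblue h)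

/-- **Consistency on overlapping blocks**: two vertices of `U ∖ s` whose lobe blocks share an edge are both red-reached or both not.
[this work] -/
theorem red_iff_of_mem_lblock (hI : ∀ v, v ≠ s → ¬ ((openGraph (T ∩ E)).Reachable s v ∧ (openGraph (Tᶜ ∩ E)).Reachable s v))
    {w z : V} (hw : w ∈ uni E s T ∧ w ≠ s) (hz : z ∈ uni E s T ∧ z ≠ s) {e : Sym2 V} (hew : e ∈ lblock E s T w)
    (hez : e ∈ lblock E s T z) :
    ((openGraph (T ∩ E)).Reachable s w ↔ (openGraph (T ∩ E)).Reachable s z) := by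
  -- it suffices to find a common vertex of the two lobes
  suffices h : ∃ c, c ∈ lobe E s T w ∧ c ∈ lobe E s T z by
    obtain ⟨c, hcw, hcz⟩ := h
    exact (red_iff_of_mem_lobe hI hcw).trans (red_iff_of_mem_lobe hI hcz).symm
  obtain ⟨heE, a, ha, hae⟩ := hew
  obtain ⟨-, b, hb, hbe⟩ := hez
  by_cases hab : a = b
  · exact ⟨a, ha, hab ▸ hb⟩
  · -- `a ≠ b` are the two endpoints of `e`, both in `U ∖ s`, so `e` is inner and `b` lies in the lobe of `w` too
    have he : e = s(a, b) := by
      induction e using Sym2.ind with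
      | h p q =>
        rcases Sym2.mem_iff.1 hae with rfl | rfl <;> rcases Sym2.mem_iff.1 hbe with rfl | rfl
        · exact absurd rfl hab
        · rfl
        · exact Sym2.eq_swap
        · exact absurd rfl hab
    subst he
    have hin : s(a, b) ∈ inner E s T := by
      refine ⟨heE, fun v hv => ?_⟩
      rcases Sym2.mem_iff.1 hv with rfl | rfl
      · exact mem_uni_of_mem_lobe hw ha
      · exact mem_uni_of_mem_lobe hz hb
    exact ⟨b, mem_lobe_of_adj ha hin hab, hb⟩

/-- The top colouring on a lobe block: `e ∈ N ↔ (e ∈ T ↔ w red-reached)` for `e ∈ S(K_w)`. [this work] -/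
theorem mem_ltop_iff (hI : ∀ v, v ≠ s → ¬ ((openGraph (T ∩ E)).Reachable s v ∧ (openGraph (Tᶜ ∩ E)).Reachable s v))
    {w : V} (hw : w ∈ uni E s T ∧ w ≠ s) {e : Sym2 V} (he : e ∈ lblock E s T w) :
    (e ∈ ltop E s T ↔ (e ∈ T ↔ (openGraph (T ∩ E)).Reachable s w)) := by
  constructor
  · exact fun h => h w hw he
  · intro h z hz hez
    exact h.trans (red_iff_of_mem_lblock hI hw hz he hez)

/-- Boundary edges of a lobe coming from `U` (i.e. from `s`) are red in the top colouring. [this work] -/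
theorem boundary_mem_ltop (hI : ∀ v, v ≠ s → ¬ ((openGraph (T ∩ E)).Reachable s v ∧ (openGraph (Tᶜ ∩ E)).Reachable s v))
    {z x y : V} (hz : z ∈ uni E s T ∧ z ≠ s) (hxU : x ∈ uni E s T) (hx : x ∉ lobe E s T z) (hy : y ∈ lobe E s T z)
    (hxy : s(x, y) ∈ E) : s(x, y) ∈ ltop E s T := by
  have hxs : x = s := eq_apex_of_boundary hz hxU hx hy hxy
  subst hxs
  exact (mem_ltop_iff hI hz ⟨hxy, y, hy, Sym2.mem_mk_right x y⟩).2 (spoke_iff hI hz hy hxy)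

/-- On a lobe block a member `N ∆ A` of the part agrees with `T` or with `Tᶜ`. [this work] -/
theorem ltop_agree (hI : ∀ v, v ≠ s → ¬ ((openGraph (T ∩ E)).Reachable s v ∧ (openGraph (Tᶜ ∩ E)).Reachable s v))
    {w : V} (hw : w ∈ uni E s T ∧ w ≠ s) {A : Set (Sym2 V)} (hA : A ∈ lalg E s T) :
    (∀ e ∈ lblock E s T w, (e ∈ ltop E s T ∆ A ↔ e ∈ T)) ∨ (∀ e ∈ lblock E s T w, (e ∈ ltop E s T ∆ A ↔ e ∉ T)) := by
  rcases hA w hw with h | h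
  · by_cases hred : (openGraph (T ∩ E)).Reachable s w
    · right
      intro e he
      rw [Set.mem_symmDiff, mem_ltop_iff hI hw he]
      have := h he
      tauto
    · left
      intro e he
      rw [Set.mem_symmDiff, mem_ltop_iff hI hw he]
      have := h he
      tauto
  · by_cases hred : (openGraph (T ∩ E)).Reachable s w
    · left
      intro e he
      rw [Set.mem_symmDiff, mem_ltop_iff hI hw he]
      have := Set.disjoint_left.1 h he
      tauto
    · right
      intro e he
      rw [Set.mem_symmDiff, mem_ltop_iff hI hw he]
      have := Set.disjoint_left.1 h he
      tauto

/-- `T` lies in its own part. [this work] -/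
theorem mem_lpart_self [Fintype V]
    (hI : ∀ v, v ≠ s → ¬ ((openGraph (T ∩ E)).Reachable s v ∧ (openGraph (Tᶜ ∩ E)).Reachable s v)) : T ∈ lpart E s T := by
  rw [lpart, Finset.mem_image]
  refine ⟨ltop E s T ∆ T, ?_, symmDiff_symmDiff_cancel_left _ _⟩
  rw [Finset.mem_filter]
  refine ⟨Finset.mem_univ _, fun w hw => ?_⟩
  by_cases hred : (openGraph (T ∩ E)).Reachable s w
  · right
    rw [Set.disjoint_left]
    intro e he
    rw [Set.mem_symmDiff, mem_ltop_iff hI hw he]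
    tauto
  · left
    intro e he
    rw [Set.mem_symmDiff, mem_ltop_iff hI hw he]
    tauto

/-- `s` is never sealed. [this work] -/
theorem apex_not_mem_sealedSet (B : Set (Sym2 V)) : s ∉ sealedSet E s T B := by
  rintro (⟨x, hx, -, hsx⟩ | h)
  · exact apex_not_mem_lobe hx.2 hsx
  · exact h apex_mem_uni

/-- **The sealed set is sealed**: for `B` in the block algebra, no red edge of `N ∆ B` goes from outside the sealed set of `B` into it
(lobes inside `B` have their `s`-edges flipped to blue and no other neighbours in `U`; `V ∖ U` is entered only from up lobes, along edges
that are blue in the top). [this work] -/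
theorem sealed (hI : ∀ v, v ≠ s → ¬ ((openGraph (T ∩ E)).Reachable s v ∧ (openGraph (Tᶜ ∩ E)).Reachable s v))
    {B : Set (Sym2 V)} (hB : B ∈ lalg E s T) :
    ∀ x y, x ∉ sealedSet E s T B → y ∈ sealedSet E s T B → s(x, y) ∉ (ltop E s T ∆ B) ∩ E := by
  intro x y hx hy hxy
  have hxU : x ∈ uni E s T := by
    by_contra h
    exact hx (Or.inr h)
  rcases hy with ⟨z, hz, hzB, hyz⟩ | hyU
  · -- `y` in a lobe inside `B`: the edge is a boundary edge (from `s`), red in the top, flipped in `N ∆ B`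
    have hxz : x ∉ lobe E s T z := fun h => hx (Or.inl ⟨z, hz, hzB, h⟩)
    have heN : s(x, y) ∈ ltop E s T := boundary_mem_ltop hI hz hxU hxz hyz hxy.2
    have heB : s(x, y) ∈ B := hzB ⟨hxy.2, y, hyz, Sym2.mem_mk_right x y⟩
    have := hxy.1
    rw [Set.mem_symmDiff] at this
    rcases this with ⟨_, h⟩ | ⟨_, h⟩
    · exact h heB
    · exact h heN
  · -- `y ∉ U`: the edge leaves `U` from the up lobe of `x`, where it is blue in the top and untouched by `B`
    obtain ⟨hxs, hcol⟩ := outer_edge hxU hyU hxy.2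
    have hxw : x ∈ uni E s T ∧ x ≠ s := ⟨hxU, hxs⟩
    have hex : s(x, y) ∈ lblock E s T x := ⟨hxy.2, x, mem_lobe_self x, Sym2.mem_mk_left x y⟩
    have hdis : Disjoint (lblock E s T x) B := by
      rcases hB x hxw with h | h
      · exact absurd (Or.inl ⟨x, hxw, h, mem_lobe_self x⟩) hx
      · exact h
    have heB : s(x, y) ∉ B := fun h => Set.disjoint_left.1 hdis hex h
    have := hxy.1
    rw [Set.mem_symmDiff] at this
    rcases this with ⟨hN, _⟩ | ⟨h, _⟩
    · rw [mem_ltop_iff hI hxw hex] at hN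
      exact (hcol.1 (hN.2 (by
        by_contra hr
        exact absurd (hcol.2 hr) (fun hT => hr (hN.1 hT))))) (hN.1 (hcol.2 fun hr => (hcol.1 (hN.2 hr)) hr))
    · exact heB h

end Basic

end Slice

end Antithetic

end Summit.CriticalPhenomena.PercolationContinuityZ3.Theorems
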